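import Mathlib.Analysis.Normed.Group.FunctionSeries
import Mathlib.Topology.Order.Compact
import Literature.Analysis.FluidPDE.CompressibleEulerImplosionSonicAnalytic
import Literature.Analysis.FluidPDE.CompressibleEulerImplosionSonicContinuity
import HarnessLib

/-!
# Buckmaster–Cao-Labora–Gómez-Serrano at `γ = 5/3`: the branch through `P_s` is jointly continuous in `(r, ξ)`

Topic `Literature/Analysis/FluidPDE`; namespace
`Literature.Analysis.FluidPDE.BuckmasterCaolaboraGomezserrano2025.Monatomic.SonicSeries`. Sequel of
`CompressibleEulerImplosionSonicAnalytic.lean` (the analytic branch `Wloc r`, `Zloc r` through `P_s`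
with explicit majorant constants `geoK`, `geoM` and radius `sonicRad`) and of
`CompressibleEulerImplosionSonicContinuity.lean` (continuity of every coefficient `wₙ(r), zₙ(r)` on
`(r₃, r₄)`), companion of `CompressibleEulerImplosion.lean` (named fact
`BuckmasterCaolaboraGomezserrano2025_thm11_monatomic`, THEOREM 1.1 of T. Buckmaster,
G. Cao-Labora, J. Gómez-Serrano, *Smooth imploding solutions for 3D compressible fluids*,
Forum Math. Pi 13 (2025) e6, arXiv:2208.09445, at `γ = 5/3`).

Brick C2 part 2 of the discharge plan — the function-level half of the continuity statement of
Proposition 2.3 ("`(W^{(r)}, Z^{(r)})` is continuous with respect to `r`"): the constants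
`slopeK`, `recQ`, `geoK`, `geoM` are continuous on `(r₃, r₄)`, hence bounded on compact
sub-intervals `[a, b]`; the series then converge uniformly on `[a, b] × (−ρ, ρ)` with a uniform
`ρ ≤ sonicRad r`, and `(r, ξ) ↦ W^{(r)}(ξ)`, `(r, ξ) ↦ Z^{(r)}(ξ)` are continuous there
(`continuousOn_Wloc_Zloc`). Theorems only. [cite: BuckmasterCaolaboraGomezserrano2025, Prop. 2.3]
-/

noncomputable section

open Set Filter Topology

namespace Literature.Analysis.FluidPDE

namespace BuckmasterCaolaboraGomezserrano2025

namespace Monatomic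

namespace SonicSeries

section JointContinuity

/-- Uniform convergence ⇒ joint continuity: if `r ↦ fₙ(r)` is continuous on `(r₃, r₄)` for each
`n` and `|fₙ(r)| ≤ K Mⁿ` for `r ∈ J ⊆ (r₃, r₄)`, then `(r, ξ) ↦ Σ fₙ(r) ξⁿ` is continuous on
`J × (−1/(2M), 1/(2M))`. [folklore] -/
theorem continuousOn_series {f : ℝ → ℕ → ℝ} {J : Set ℝ} {K M : ℝ} (hJ : ∀ r ∈ J, r ∈ Ioo r3 r4)
    (hf : ∀ n, ContinuousOn (fun r => f r n) (Ioo r3 r4)) (hM : 0 < M) (hK : 0 ≤ K)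
    (hb : ∀ r ∈ J, ∀ n, |f r n| ≤ K * M ^ n) :
    ContinuousOn (fun p : ℝ × ℝ => ∑' n, f p.1 n * p.2 ^ n) (J ×ˢ Metric.ball (0 : ℝ) (1 / (2 * M))) := by
  refine continuousOn_tsum (u := fun n => K * (1 / 2) ^ n) (fun n => ?_) ?_ (fun n p hp => ?_)
  · exact ((hf n).comp continuousOn_fst (fun p hp => hJ p.1 hp.1)).mul
      ((continuous_snd.pow n).continuousOn)
  · exact summable_geometric_two.mul_left K
  · obtain ⟨hr, hξ⟩ := hp
    have hξ' : |p.2| < 1 / (2 * M) := by simpa [Real.dist_eq] using hξ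
    have hMξ : M * |p.2| ≤ 1 / 2 := half_of_lt hM hξ'
    rw [Real.norm_eq_abs, abs_mul, abs_pow]
    calc |f p.1 n| * |p.2| ^ n ≤ K * M ^ n * |p.2| ^ n := by
          gcongr; exact hb p.1 hr n
      _ = K * (M * |p.2|) ^ n := by rw [mul_pow]; ring
      _ ≤ K * (1 / 2) ^ n := by gcongr

/-- [folklore] -/
theorem continuousOn_av (n : ℕ) : ContinuousOn (fun r => av r n) (Ioo r3 r4) := by
  unfold av
  exact ((continuous_abs.comp_continuousOn (continuousOn_w n))).add
    (continuous_abs.comp_continuousOn (continuousOn_z n))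

/-- [folklore] -/
theorem continuousOn_slopeZ (m : ℕ) :
    ContinuousOn (fun r => slopeZ r (w r) (z r) m) (Ioo r3 r4) := by
  have h0w := continuousOn_w (n := 0) 
  have h0z := continuousOn_z (n := 0)
  have h1w := continuousOn_w (n := 1)
  have h1z := continuousOn_z (n := 1)
  show ContinuousOn (fun r => dZc (w r) (z r) 1 * (m : ℝ) + 2 / 3 * z r 1
    - NZ_Z r (w r 0) (z r 0)) (Ioo r3 r4)
  simp only [dZc_one]
  unfold NZ_Z
  exact ((((h1w.add (continuousOn_const.mul h1z)).div_const 3).mul continuousOn_const).add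
    (continuousOn_const.mul h1z)).sub
    ((continuousOn_id.add (h0w.div_const 3)).add ((continuousOn_const.mul h0z).div_const 3)).neg

/-- [folklore] -/
theorem continuousOn_slopeK : ContinuousOn slopeK (Ioo r3 r4) := by
  have hm := r3_r4_mem
  have hD : ∀ r ∈ Ioo r3 r4, 2 - r - p r ≠ 0 := fun r hr => (DZ1_pos (hr.2.trans hm.2.2)).ne'
  have hs : ∀ m, ∀ r ∈ Ioo r3 r4, |slopeZ r (w r) (z r) m| ≠ 0 := fun m r hr =>
    abs_ne_zero.mpr (slopeZ_ne hr.1 hr.2 m)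
  have hp : ContinuousOn (fun r => 2 - r - p r) (Ioo r3 r4) :=
    (continuousOn_const.sub continuousOn_id).sub continuous_p.continuousOn
  have ha : ∀ m, ContinuousOn (fun r => |slopeZ r (w r) (z r) m|) (Ioo r3 r4) := fun m =>
    continuous_abs.comp_continuousOn (continuousOn_slopeZ m)
  unfold slopeK
  exact (continuousOn_const.div hp hD).sup ((continuousOn_const.div (ha 2) (hs 2)).sup
    ((continuousOn_const.div (ha 3) (hs 3)).sup (continuousOn_const.div (ha 4) (hs 4))))

/-- [folklore] -/
theorem continuousOn_DW_Ps : ContinuousOn (fun r => DW (W0 r) (Z0 r)) (Ioo r3 r4) := by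
  simp only [DW_Ps]
  have := continuous_q
  exact Continuous.continuousOn (by fun_prop)

/-- [folklore] -/
theorem continuousOn_coefW : ContinuousOn (fun r => coefW (w r) (z r)) (Ioo r3 r4) := by
  show ContinuousOn (fun r => z r 1 / 3 - NZ_W (w r 0) (z r 0)) (Ioo r3 r4)
  unfold NZ_W
  exact ((continuousOn_z 1).div_const 3).sub (((continuousOn_w 0).sub (continuousOn_z 0)).div_const 3)

/-- [folklore] -/
theorem continuousOn_recQ : ContinuousOn recQ (Ioo r3 r4) := by
  have hm := r3_r4_mem
  have hD : ∀ r ∈ Ioo r3 r4, DW (W0 r) (Z0 r) ≠ 0 := fun r hr =>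
    (DW_Ps_pos (show r < 2 by linarith [hr.2.trans hm.2.2, rstar_lt])).ne'
  unfold recQ
  have h1 : ContinuousOn (fun r => 1 + slopeK r * |coefW (w r) (z r)|) (Ioo r3 r4) :=
    continuousOn_const.add (continuousOn_slopeK.mul
      (continuous_abs.comp_continuousOn continuousOn_coefW))
  have h2 : ContinuousOn (fun r => 3 + (|r| + 8 / 3 * av r 0)) (Ioo r3 r4) :=
    continuousOn_const.add ((continuous_abs.continuousOn).add
      (continuousOn_const.mul (continuousOn_av 0)))
  exact ((h1.div continuousOn_DW_Ps hD).mul h2).add (continuousOn_const.mul continuousOn_slopeK)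

/-- [folklore] -/
theorem continuousOn_geoK : ContinuousOn geoK (Ioo r3 r4) := by
  unfold geoK
  exact (((continuousOn_const.add (continuousOn_av 2)).add ((continuousOn_av 1).pow 2)).add
    (continuousOn_av 0)).add (continuousOn_av 1)

/-- [folklore] -/
theorem continuousOn_geoM : ContinuousOn geoM (Ioo r3 r4) := by
  unfold geoM
  exact continuousOn_const.mul (continuousOn_const.add (continuousOn_recQ.mul
    ((continuousOn_const.add (continuousOn_const.mul (continuousOn_av 1))).add
      (continuousOn_const.mul (continuousOn_const.add (continuousOn_av 2) |>.add
        ((continuousOn_av 1).pow 2))))))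

/-- **Proposition 2.3 at `γ = 5/3`, continuity in `r`.** On every compact sub-interval
`[a, b] ⊂ (r₃, r₄)` there is a uniform radius `ρ > 0` (`ρ ≤ sonicRad r` for all `r ∈ [a, b]`, so
`sonicSeries_spec'` applies on `|ξ| < ρ` for each such `r`) such that
`(r, ξ) ↦ W^{(r)}(ξ)` and `(r, ξ) ↦ Z^{(r)}(ξ)` are continuous on `[a, b] × (−ρ, ρ)`.
[cite: BuckmasterCaolaboraGomezserrano2025, Prop. 2.3] -/
theorem continuousOn_Wloc_Zloc {a b : ℝ} (ha : r3 < a) (hb : b < r4) (hab : a ≤ b) :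
    ∃ ρ : ℝ, 0 < ρ ∧ (∀ r ∈ Icc a b, ρ ≤ sonicRad r) ∧
      ContinuousOn (fun p : ℝ × ℝ => Wloc p.1 p.2) (Icc a b ×ˢ Metric.ball (0 : ℝ) ρ) ∧
      ContinuousOn (fun p : ℝ × ℝ => Zloc p.1 p.2) (Icc a b ×ˢ Metric.ball (0 : ℝ) ρ) := by
  have hm := r3_r4_mem
  have hJ : Icc a b ⊆ Ioo r3 r4 := fun r hr => ⟨ha.trans_le hr.1, hr.2.trans_lt hb⟩
  have hJc : IsCompact (Icc a b) := isCompact_Icc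
  have hJn : (Icc a b).Nonempty := nonempty_Icc.mpr hab
  -- uniform constants on `[a, b]`
  obtain ⟨rM, hrM, hMmax⟩ := hJc.exists_isMaxOn hJn (continuousOn_geoM.mono hJ)
  obtain ⟨rK, hrK, hKmax⟩ := hJc.exists_isMaxOn hJn (continuousOn_geoK.mono hJ)
  set Ms := geoM rM with hMs
  set Ks := geoK rK with hKs
  have hMs4 : 4 ≤ Ms := four_le_geoM ((hJ hrM).2.trans hm.2.2)
  have hMs0 : 0 < Ms := by linarith
  have hKs0 : 0 < Ks := geoK_pos rK
  have hMle : ∀ r ∈ Icc a b, geoM r ≤ Ms := fun r hr => hMmax hr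
  have hKle : ∀ r ∈ Icc a b, geoK r ≤ Ks := fun r hr => hKmax hr
  refine ⟨1 / (2 * Ms), by positivity, fun r hr => ?_, ?_, ?_⟩
  · -- `ρ ≤ sonicRad r`
    unfold sonicRad
    have h4 := four_le_geoM ((hJ hr).2.trans hm.2.2)
    exact one_div_le_one_div_of_le (by positivity) (by nlinarith [hMle r hr])
  · -- `W`
    exact continuousOn_series (fun r hr => hJ hr) (fun n => continuousOn_w n) hMs0 hKs0.le
      (fun r hr n => ((abs_w_le_av n).trans (av_le_geom (hJ hr).1 (hJ hr).2 n)).trans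
        (mul_le_mul (hKle r hr) (pow_le_pow_left₀ (by linarith [four_le_geoM ((hJ hr).2.trans hm.2.2)]) (hMle r hr) n)
          (by have := four_le_geoM ((hJ hr).2.trans hm.2.2); positivity) hKs0.le))
  · -- `Z`
    exact continuousOn_series (fun r hr => hJ hr) (fun n => continuousOn_z n) hMs0 hKs0.le
      (fun r hr n => ((abs_z_le_av n).trans (av_le_geom (hJ hr).1 (hJ hr).2 n)).trans
        (mul_le_mul (hKle r hr) (pow_le_pow_left₀ (by linarith [four_le_geoM ((hJ hr).2.trans hm.2.2)]) (hMle r hr) n)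
          (by have := four_le_geoM ((hJ hr).2.trans hm.2.2); positivity) hKs0.le))

end JointContinuity


end SonicSeries

end Monatomic

end BuckmasterCaolaboraGomezserrano2025

end Literature.Analysis.FluidPDE
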